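import Mathlib.NumberTheory.ModularForms.JacobiTheta.TwoVariable
import Mathlib.Analysis.Normed.Module.FiniteDimension
import Mathlib.Analysis.SpecificLimits.Basic
import Mathlib.Analysis.Complex.ExponentialBounds
import Mathlib.Analysis.Real.Pi.Bounds
import HarnessLib

/-!
# A sup bound for the genus-one theta function:
# `e^{-π y²/Im τ} |ϑ(x + iy; τ)| ≤ 2/(1 - e^{-π Im τ})`
# (Javanpeykar 2014, Lemma 2.4.2, inequality (2.4.2), for `g = 1`)

Topic `Analysis/SpecialFunctions` (theta functions: cf. `JacobiThetaAGM.lean`,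
`JacobiThetaAxisDerivatives.lean`). In A. Javanpeykar, *Polynomial bounds for Arakelov invariants
of Belyi curves*, Algebra & Number Theory **8** (2014), arXiv:1403.6404, Lemma 2.4.2 (a proof due to
R. de Jong) bounds `log ‖ϑ‖_max(X)` through Bost's bound on `det Im τ` and the inequality

> (2.4.2) `exp(-π ᵗy (Im τ)⁻¹ y) |ϑ(z; τ)| ≤ 2^{3g³ + 5g}`

for `τ` in the Siegel fundamental domain `𝓕_g` and `z = x + iy ∈ ℂ^g`, proved by
`≤ Σ_{n ∈ ℤ^g} exp(-π ᵗ(n+b) Im τ (n+b))` (`y = Im τ · b`), Minkowski reduction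
(`ᵗm Im τ m ≥ c(g) Σ mᵢ² (Im τ)ᵢᵢ`, `(Im τ)ᵢᵢ ≥ √3/2`) and the one-variable estimate
`Σ_{n ∈ ℤ} exp(-π c (n + bᵢ)² (Im τ)ᵢᵢ) ≤ 2/(1 - exp(-π c (Im τ)ᵢᵢ))`. We prove the genus-one case
(`c(1) = 1`, `𝓕₁` = the standard fundamental domain, where `Im τ ≥ √3/2`) for Mathlib's
two-variable theta function `jacobiTheta₂ z τ = Σ_n e^{2πinz + πin²τ} = ϑ(z; τ)`, in the sharper
closed form:

* `tsum_exp_neg_mul_sq_le` — **`Σ_{n ∈ ℤ} e^{-a(n+b)²} ≤ 2/(1 - e^{-a})`** (`a > 0`, `b ∈ ℝ`),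
  with summability;
* `exp_mul_norm_jacobiTheta₂_le` — **`e^{-π (Im z)²/Im τ} |ϑ(z; τ)| ≤ 2/(1 - e^{-π Im τ})`** for
  every `τ ∈ ℍ`, `z ∈ ℂ` (completing the square, `exp_mul_norm_jacobiTheta₂_term`);
* `exp_mul_norm_jacobiTheta₂_le_two_pow_eight` — (2.4.2) for `g = 1`: if `Im τ ≥ √3/2` then the
  left-hand side is `≤ 2⁸` (indeed `≤ 3`).

Everything is proved; no definition, no named fact. The genus-`g` statement (Riemann theta in
`g` variables, Siegel reduction) is not attempted: Mathlib has no Riemann theta function for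
`g ≥ 2`.

## References

* A. Javanpeykar, *Polynomial bounds for Arakelov invariants of Belyi curves* (appendix by
  P. Bruin), Algebra & Number Theory 8 (2014), no. 1, 89–140, doi:10.2140/ant.2014.8.89,
  arXiv:1403.6404: Lemma 2.4.2 and its proof, inequality (2.4.2). [Javanpeykar2014]
* J.-I. Igusa, *Theta Functions*, Springer (1972), Ch. V §4 (Minkowski reduction; the facts quoted
  in the printed proof).
-/

noncomputable section

open Real Filter Topology

namespace Literature.Analysis.SpecialFunctions

/-! ### Shifted Gaussian sums over `ℤ` -/

/-- **`Σ_{n ∈ ℤ} e^{-a(n+b)²} ≤ 2/(1 - e^{-a})`** for `a > 0` and every real `b` (shift `b` into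
`[0, 1)`; the `n ≥ 0` and `n < 0` halves are each dominated by the geometric series `Σ e^{-ak}`).
[folklore] -/
theorem tsum_exp_neg_mul_sq_le {a : ℝ} (ha : 0 < a) (b : ℝ) :
    Summable (fun n : ℤ ↦ rexp (-(a * ((n : ℝ) + b) ^ 2))) ∧
      ∑' n : ℤ, rexp (-(a * ((n : ℝ) + b) ^ 2)) ≤ 2 / (1 - rexp (-a)) := by
  set k : ℤ := ⌊b⌋ with hk
  set β : ℝ := b - k with hβ
  have hβ0 : 0 ≤ β := by rw [hβ, hk]; exact Int.fract_nonneg b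
  have hβ1 : β < 1 := by rw [hβ, hk]; exact Int.fract_lt_one b
  set r : ℝ := rexp (-a) with hr
  have hr0 : 0 ≤ r := (exp_pos _).le
  have hr1 : r < 1 := exp_lt_one_iff.mpr (by linarith)
  -- the shifted function `g m = f (m - k) = e^{-a (m + β)²}`
  set g : ℤ → ℝ := fun m ↦ rexp (-(a * ((m : ℝ) + β) ^ 2)) with hg
  have hfg : (fun n : ℤ ↦ rexp (-(a * ((n : ℝ) + b) ^ 2))) = fun n ↦ g (n + k) := by
    funext n
    simp only [hg, hβ]
    push_cast
    ring_nf
  have hgeom : Summable fun j : ℕ ↦ r ^ j := summable_geometric_of_lt_one hr0 hr1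
  have hpow : ∀ j : ℕ, r ^ j = rexp (-(a * j)) := by
    intro j; rw [hr, ← Real.exp_nat_mul]; ring_nf
  -- nonnegative half
  have hpos_le : ∀ j : ℕ, g j ≤ r ^ j := by
    intro j
    rw [hpow, hg]
    simp only [Int.cast_natCast]
    rw [exp_le_exp, neg_le_neg_iff]
    have hj : (0 : ℝ) ≤ j := Nat.cast_nonneg j
    have hjj : (j : ℝ) ≤ (j : ℝ) ^ 2 := by exact_mod_cast Nat.le_self_pow two_ne_zero j
    have : (j : ℝ) ≤ ((j : ℝ) + β) ^ 2 := by nlinarith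
    exact mul_le_mul_of_nonneg_left this ha.le
  have hneg_le : ∀ j : ℕ, g (-((j : ℤ) + 1)) ≤ r ^ j := by
    intro j
    rw [hpow, hg]
    simp only [Int.cast_neg, Int.cast_add, Int.cast_natCast, Int.cast_one]
    rw [exp_le_exp, neg_le_neg_iff]
    have hj : (0 : ℝ) ≤ j := Nat.cast_nonneg j
    have hjj : (j : ℝ) ≤ (j : ℝ) ^ 2 := by exact_mod_cast Nat.le_self_pow two_ne_zero j
    have h1 : (j : ℝ) ≤ (j : ℝ) + 1 - β := by linarith
    have h2 : (j : ℝ) ^ 2 ≤ ((j : ℝ) + 1 - β) ^ 2 := pow_le_pow_left₀ hj h1 2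
    have : (j : ℝ) ≤ (-((j : ℝ) + 1) + β) ^ 2 := by nlinarith
    exact mul_le_mul_of_nonneg_left this ha.le
  have hg0 : ∀ m : ℤ, 0 ≤ g m := fun m ↦ (exp_pos _).le
  have hs1 : Summable fun j : ℕ ↦ g j :=
    Summable.of_nonneg_of_le (fun j ↦ hg0 j) hpos_le hgeom
  have hs2 : Summable fun j : ℕ ↦ g (-((j : ℤ) + 1)) :=
    Summable.of_nonneg_of_le (fun j ↦ hg0 _) hneg_le hgeom
  have hsg : Summable g := Summable.of_nat_of_neg_add_one hs1 hs2
  have htsum_g : ∑' m : ℤ, g m ≤ 2 / (1 - r) := by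
    rw [tsum_of_nat_of_neg_add_one hs1 hs2]
    have h1 : ∑' j : ℕ, g j ≤ ∑' j : ℕ, r ^ j := hs1.tsum_le_tsum hpos_le hgeom
    have h2 : ∑' j : ℕ, g (-((j : ℤ) + 1)) ≤ ∑' j : ℕ, r ^ j := hs2.tsum_le_tsum hneg_le hgeom
    rw [tsum_geometric_of_lt_one hr0 hr1] at h1 h2
    rw [div_eq_mul_inv]
    linarith
  refine ⟨?_, ?_⟩
  · rw [hfg]
    exact (Equiv.addRight k).summable_iff.mpr hsg
  · rw [hfg, show (∑' n : ℤ, g (n + k)) = ∑' m : ℤ, g m from (Equiv.addRight k).tsum_eq g]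
    exact htsum_g

/-! ### The sup bound for `‖ϑ‖(z; τ)` in genus one -/

/-- Completing the square: `e^{-π y²/t} |e^{2πinz + πin²τ}| = e^{-π t (n + y/t)²}` with `t = Im τ`,
`y = Im z`. [folklore] -/
theorem exp_mul_norm_jacobiTheta₂_term (n : ℤ) (z : ℂ) {τ : ℂ} (hτ : 0 < τ.im) :
    rexp (-(π * z.im ^ 2 / τ.im)) * ‖jacobiTheta₂_term n z τ‖ =
      rexp (-(π * τ.im * ((n : ℝ) + z.im / τ.im) ^ 2)) := by
  rw [norm_jacobiTheta₂_term, ← Real.exp_add]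
  congr 1
  field_simp
  ring

/-- **Sup bound for the genus-one theta function**: for `τ ∈ ℍ` and every `z ∈ ℂ`,
`e^{-π (Im z)²/Im τ} |ϑ(z; τ)| ≤ 2/(1 - e^{-π Im τ})`, where `ϑ(z;τ) = Σ_n e^{πin²τ + 2πinz}` is
Mathlib's `jacobiTheta₂ z τ`. (The left side is Faltings' `‖ϑ‖(z;τ)` up to the factor
`(Im τ)^{1/4}`.) [folklore] -/
theorem exp_mul_norm_jacobiTheta₂_le (z : ℂ) {τ : ℂ} (hτ : 0 < τ.im) :
    rexp (-(π * z.im ^ 2 / τ.im)) * ‖jacobiTheta₂ z τ‖ ≤ 2 / (1 - rexp (-(π * τ.im))) := by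
  have hsum : Summable (jacobiTheta₂_term · z τ) := (summable_jacobiTheta₂_term_iff z τ).mpr hτ
  have hnorm : Summable fun n : ℤ ↦ ‖jacobiTheta₂_term n z τ‖ := summable_norm_iff.mpr hsum
  have h1 : ‖jacobiTheta₂ z τ‖ ≤ ∑' n : ℤ, ‖jacobiTheta₂_term n z τ‖ :=
    norm_tsum_le_tsum_norm hnorm
  have hb := tsum_exp_neg_mul_sq_le (mul_pos pi_pos hτ) (z.im / τ.im)
  calc rexp (-(π * z.im ^ 2 / τ.im)) * ‖jacobiTheta₂ z τ‖
      ≤ rexp (-(π * z.im ^ 2 / τ.im)) * ∑' n : ℤ, ‖jacobiTheta₂_term n z τ‖ :=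
        mul_le_mul_of_nonneg_left h1 (exp_pos _).le
    _ = ∑' n : ℤ, rexp (-(π * z.im ^ 2 / τ.im)) * ‖jacobiTheta₂_term n z τ‖ := by
        rw [tsum_mul_left]
    _ = ∑' n : ℤ, rexp (-(π * τ.im * ((n : ℝ) + z.im / τ.im) ^ 2)) := by
        exact tsum_congr fun n ↦ exp_mul_norm_jacobiTheta₂_term n z hτ
    _ ≤ 2 / (1 - rexp (-(π * τ.im))) := hb.2

/-- `e^{-π√3/2} ≤ 1/3`. [folklore] -/
theorem exp_neg_pi_mul_sqrt_three_div_two_le : rexp (-(π * (Real.sqrt 3 / 2))) ≤ 1 / 3 := by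
  have h3 : (3 / 2 : ℝ) ≤ Real.sqrt 3 := by
    rw [Real.le_sqrt (by norm_num) (by norm_num)]; norm_num
  have hπ := pi_gt_three
  have hx : (2 : ℝ) ≤ π * (Real.sqrt 3 / 2) := by nlinarith
  rw [Real.exp_neg, inv_le_comm₀ (exp_pos _) (by norm_num)]
  have h := Real.add_one_le_exp (π * (Real.sqrt 3 / 2))
  linarith

/-- **Javanpeykar 2014, Lemma 2.4.2, inequality (2.4.2) ["yeah2"], genus `1`.** For `τ` in the
Siegel (= standard) fundamental domain of `SL₂(ℤ)` — indeed for every `τ` with `Im τ ≥ √3/2` — and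
every `z = x + iy ∈ ℂ`: `exp(-π y (Im τ)⁻¹ y) |ϑ(z; τ)| ≤ 2^{3g³+5g} = 2⁸` (`g = 1`). The printed
proof: `≤ Σ_{n ∈ ℤ} exp(-π (n + b)² Im τ)` (`b = y/Im τ`) `≤ 2/(1 - exp(-π c(1) Im τ))`
`≤ 2 (1 + 2/(π√3 c(1)))`, `c(1) = 1`, `(Im τ)₁₁ ≥ √3/2`; here the middle bound is
`exp_mul_norm_jacobiTheta₂_le` and `2/(1 - e^{-π√3/2}) ≤ 3 ≤ 2⁸`.
[cite: Javanpeykar2014, Lemma 2.4.2 (proof, (2.4.2))] -/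
theorem exp_mul_norm_jacobiTheta₂_le_two_pow_eight (z : ℂ) {τ : ℂ}
    (hτ : Real.sqrt 3 / 2 ≤ τ.im) :
    rexp (-(π * z.im ^ 2 / τ.im)) * ‖jacobiTheta₂ z τ‖ ≤ 2 ^ 8 := by
  have h3 : (0 : ℝ) < Real.sqrt 3 / 2 := by positivity
  have hτ0 : 0 < τ.im := h3.trans_le hτ
  refine (exp_mul_norm_jacobiTheta₂_le z hτ0).trans ?_
  have he : rexp (-(π * τ.im)) ≤ 1 / 3 := by
    refine le_trans (exp_le_exp.mpr ?_) exp_neg_pi_mul_sqrt_three_div_two_le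
    nlinarith [pi_pos]
  rw [div_le_iff₀ (by linarith)]
  linarith

end Literature.Analysis.SpecialFunctions

end
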